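import Summits.Ventures.PercRepro.C026PFunCorner
import Summits.Ventures.PercRepro.C026PFunSlack

/-!
# Two live vertices: the `(P)` functional as a sum over the `5 × 5` type matrix (p6, gen 17;
mine-3 §35)

A skeleton with probe `c` and two **live** vertices `a, b` — every other vertex bare, the probe
bare — has cells `twoCells a b x₁ x₂` (`x₁` at `a`, `x₂` at `b`, `1` elsewhere) and likewise
`twoCells a b K₁ K₂`.  Every factor of the configuration sum is then a function of the connection
pattern of `(c, a, b)` in `ω` and in `ωᶜ` (`xCluster_twoCells`, `nbar_twoCells`,
`nbarOff_twoCells`; no distinctness of `a, b, c` is needed for them), so `(P) = ∑_ω twoLiveVal x₁ K₁ x₂ K₂ (c ~ a) (c ~ b) (a ~ b) (a ~_ωᶜ b)`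
(`pFun_twoCells_eq_sum`) — mine-3's `(P) = ∑_{(π_r, π_b)} n(π_r, π_b)·val(π_r, π_b)` in
configuration form.  This is the bookkeeping behind THEOREM L2 (`C026PFunTwoLiveNonneg`).
-/

namespace PercRepro

namespace MultiGraph

open Finset

variable {V E : Type*} [Fintype V] [DecidableEq V]

/-- Cells with two live vertices: `x₁` at `a`, `x₂` at `b`, `1` elsewhere (`a ≠ b`). -/
noncomputable def twoCells (a b : V) (x₁ x₂ : ℝ) : V → ℝ :=
  fun v => (if v = a then x₁ else 1) * (if v = b then x₂ else 1)

omit [Fintype V] in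
/-- At `(0, 0)` the two-live cells are the all-corner cells of `C026PFunCorner`. -/
theorem twoCells_zero_zero (a b : V) : twoCells a b 0 0 = liveCells a b := by
  funext v
  simp only [twoCells, liveCells]
  by_cases ha : v = a <;> by_cases hb : v = b <;> simp [ha, hb]

omit [Fintype V] in
/-- The product of the two-live cells over a vertex set. -/
theorem prod_twoCells (a b : V) (x₁ x₂ : ℝ) (R : Finset V) :
    ∏ v ∈ R, twoCells a b x₁ x₂ v = (if a ∈ R then x₁ else 1) * (if b ∈ R then x₂ else 1) := by
  unfold twoCells
  rw [Finset.prod_mul_distrib, Finset.prod_ite_eq', Finset.prod_ite_eq']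

variable {G : MultiGraph V E}

open Classical in
/-- `X_c` with two live vertices. -/
theorem xCluster_twoCells (a b c : V) (x₁ x₂ : ℝ) (ω : Config E) :
    G.xCluster (twoCells a b x₁ x₂) c ω =
      (if G.Conn ω c a then x₁ else 1) * (if G.Conn ω c b then x₂ else 1) := by
  unfold xCluster
  rw [prod_twoCells]
  simp only [mem_clusterF]

open Classical in
/-- `K_c` with two live vertices. -/
theorem kCluster_twoCells (a b c : V) (K₁ K₂ : ℝ) (ω : Config E) :
    G.kCluster (twoCells a b K₁ K₂) c ω =
      (if G.Conn ω c a then K₁ else 1) * (if G.Conn ω c b then K₂ else 1) := by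
  unfold kCluster
  rw [prod_twoCells]
  simp only [mem_clusterF]

open Classical in
/-- `n̄` with two live vertices: `2 − x₁x₂` if they are joined, else `(2 − x₁)(2 − x₂)`. -/
theorem nbar_twoCells (a b : V) (x₁ x₂ : ℝ) (ω : Config E) :
    G.nbar (twoCells a b x₁ x₂) ω =
      if G.Conn ω a b then 2 - x₁ * x₂ else (2 - x₁) * (2 - x₂) := by
  unfold nbar
  -- only the clusters of `a` and of `b` contribute
  have hsub : ({G.clusterF ω a, G.clusterF ω b} : Finset (Finset V)) ⊆ G.clusters ω := by
    intro R hR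
    simp only [Finset.mem_insert, Finset.mem_singleton] at hR
    rcases hR with rfl | rfl
    · exact clusterF_mem_clusters ω a
    · exact clusterF_mem_clusters ω b
  rw [← Finset.prod_subset hsub]
  · by_cases hab' : G.Conn ω a b
    · rw [if_pos hab', clusterF_eq_of_conn hab', Finset.pair_eq_singleton, Finset.prod_singleton,
        prod_twoCells, if_pos (mem_clusterF.2 hab'.symm), if_pos (self_mem_clusterF ω b)]
    · have hne : G.clusterF ω a ≠ G.clusterF ω b := fun h => hab' (conn_of_clusterF_eq h)
      rw [if_neg hab', Finset.prod_pair hne, prod_twoCells, prod_twoCells,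
        if_pos (self_mem_clusterF ω a), if_pos (self_mem_clusterF ω b),
        if_neg (fun h => hab' (mem_clusterF.1 h)), if_neg (fun h => hab' (mem_clusterF.1 h).symm)]
      ring
  · intro R hR hR'
    rw [prod_twoCells]
    simp only [Finset.mem_insert, Finset.mem_singleton, not_or] at hR'
    rw [if_neg (fun h => hR'.1 (clusterF_eq_of_mem hR h).symm),
      if_neg (fun h => hR'.2 (clusterF_eq_of_mem hR h).symm)]
    ring

open Classical in
/-- `N_c` with two live vertices (bare probe), by `n̄ = (2 − X_c)·N_c`; cells in `[0, 1]`. -/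
theorem nbarOff_twoCells (a b c : V) {x₁ x₂ : ℝ} (hx₁ : 0 ≤ x₁ ∧ x₁ ≤ 1)
    (hx₂ : 0 ≤ x₂ ∧ x₂ ≤ 1) (ω : Config E) :
    G.nbarOff (twoCells a b x₁ x₂) c ω =
      if G.Conn ω c a then (if G.Conn ω c b then 1 else 2 - x₂)
      else (if G.Conn ω c b then 2 - x₁
        else (if G.Conn ω a b then 2 - x₁ * x₂ else (2 - x₁) * (2 - x₂))) := by
  have h := G.nbar_eq_mul_nbarOff (twoCells a b x₁ x₂) c ω
  rw [nbar_twoCells, xCluster_twoCells] at h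
  have r1 : G.Conn ω c a → G.Conn ω c b → G.Conn ω a b := fun h1 h2 => h1.symm.trans h2
  have r2 : G.Conn ω c a → G.Conn ω a b → G.Conn ω c b := fun h1 h2 => h1.trans h2
  have r3 : G.Conn ω c b → G.Conn ω a b → G.Conn ω c a := fun h1 h2 => h1.trans h2.symm
  have h12 : 0 < 2 - x₁ * x₂ := by nlinarith
  have h1 : 0 < 2 - x₁ := by linarith
  have h2 : 0 < 2 - x₂ := by linarith
  by_cases hra : G.Conn ω c a <;> by_cases hrb : G.Conn ω c b <;> by_cases hrab : G.Conn ω a b <;>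
    simp only [hra, hrb, hrab, if_true, if_false, mul_one, one_mul] at h ⊢ <;>
    first
    | linarith
    | exact absurd (r1 hra hrb) hrab
    | exact absurd (r2 hra hrab) hrb
    | exact absurd (r3 hrb hrab) hra
    | (apply mul_left_cancel₀ (ne_of_gt h12); linarith)
    | (apply mul_left_cancel₀ (ne_of_gt h1); linarith)
    | (apply mul_left_cancel₀ (ne_of_gt h2); linarith)

/-! ### The summand as a function of the type pattern -/

/-- The `(P)`-summand of a configuration with two live vertices (bare probe) as a function of
the red pattern `ra = (c ~ a)`, `rb = (c ~ b)`, `rab = (a ~ b)` and of `bab = (a ~ b in ωᶜ)`: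
`N_c·(1 − 2X_c) + K_c·n̄(ωᶜ)` (`nbarOff_twoCells`, `xCluster_twoCells`, `kCluster_twoCells`,
`nbar_twoCells`). -/
noncomputable def twoLiveVal (x₁ K₁ x₂ K₂ : ℝ) (ra rb rab bab : Prop) [Decidable ra] [Decidable rb]
    [Decidable rab] [Decidable bab] : ℝ :=
  (if ra then (if rb then 1 else 2 - x₂)
      else (if rb then 2 - x₁ else (if rab then 2 - x₁ * x₂ else (2 - x₁) * (2 - x₂)))) *
    (1 - 2 * ((if ra then x₁ else 1) * (if rb then x₂ else 1))) +
  ((if ra then K₁ else 1) * (if rb then K₂ else 1)) *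
    (if bab then 2 - x₁ * x₂ else (2 - x₁) * (2 - x₂))

variable [Fintype E] [DecidableEq E]

open Classical in
/-- **`(P)` with two live vertices as a configuration sum over the type patterns**
(mine-3 §35: `(P) = ∑ n(π_r, π_b)·val(π_r, π_b)`). -/
theorem pFun_twoCells_eq_sum (a b c : V) {x₁ x₂ : ℝ} (hx₁ : 0 ≤ x₁ ∧ x₁ ≤ 1)
    (hx₂ : 0 ≤ x₂ ∧ x₂ ≤ 1) (K₁ K₂ : ℝ) :
    G.pFun c (twoCells a b x₁ x₂) (twoCells a b K₁ K₂) univ =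
      ∑ ω : Config E, twoLiveVal x₁ K₁ x₂ K₂ (G.Conn ω c a) (G.Conn ω c b) (G.Conn ω a b)
        (G.Conn ωᶜ a b) := by
  unfold pFun
  rw [configsIn_univ]
  simp only [complIn_univ, ← config_compl_eq_not]
  refine Finset.sum_congr rfl fun ω _ => ?_
  rw [nbarOff_twoCells a b c hx₁ hx₂, xCluster_twoCells, kCluster_twoCells, nbar_twoCells]
  rfl

end MultiGraph

end PercRepro
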